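import Mathlib
import Summits.Ventures.PercRepro2.Defs
import Summits.Ventures.PercRepro2.Harris
import Summits.Ventures.PercRepro2.Graph
import Summits.Ventures.PercRepro2.Events
import Summits.Ventures.PercRepro2.R21PairFrame
import Summits.Ventures.PercRepro2.PsiBernAllDefs

/-!
# (Ψ) from the nonnegativity of its tensor-Bernstein coefficients (PercRepro2, p2)

With the trilinear form `psiTri` and the antipodal coefficients `psiAnti` of PsiBernAllDefs.lean,
for an edge `g ∉ F` and `w = p_g` (`psiAnti_bernstein`)

  `M_{F,τ}(p) = (1 − w)³·M_{F,τ}(p[g↦0]) + 3w(1 − w)²·M_{F∪{g},τ[g↦true]}(p)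
                 + 3w²(1 − w)·M_{F∪{g},τ[g↦false]}(p) + w³·M_{F,τ}(p[g↦1])`

(the two mixed sums are `3·M_{F∪{g},·}` by the cyclic shift `cycAt g` of `E → Fin 3`:
`psiAnti_mixed_one`, `psiAnti_mixed_two`), so the pin induction (`pin_induction`) gives:
**if every antipodal coefficient at every point mass is nonnegative — (BERN-Ψ-ALL):
`0 ≤ M_{F,τ}(p)` for all `p ∈ {0,1}^E`, `F`, `τ` — then (Ψ) holds for every admissible weight
vector** (`psi_of_bernall`).  (BERN-Ψ-ALL) says that every coefficient of `Σ_𝓤` in the tensor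
Bernstein basis of degree 3 is nonnegative; it is a finite integer inequality per multigraph,
marks and up-set (P2-G20 record: 0 negative coefficients on 3,728,576 coefficients in census).

* `psiAnti_mixed_one`, `psiAnti_mixed_two` — the two mixed sums;
* `psiAnti_bernstein` — the one-edge expansion of the antipodal coefficients;
* `psi_of_bernall` — **(BERN-Ψ-ALL) ⟹ (Ψ)**.
-/

namespace Summit.Ventures.PercRepro2

section PsiBernAll

variable {V : Type*} {E : Type*} [Fintype E] [DecidableEq E]
  {R : Type*} [CommRing R] [LinearOrder R] [IsStrictOrderedRing R]

omit [LinearOrder R] [IsStrictOrderedRing R] in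
/-- **The mixed sum of the one-open terms is `3·M_{F ∪ {g}, τ[g↦true]}`** (`g ∉ F`). -/
lemma psiAnti_mixed_one (ends : E → Sym2 V) (s t o u : V) (𝓤 : Set (Set V)) (p : E → R)
    {F : Finset E} (τ : E → Bool) {g : E} (hg : g ∉ F) :
    (∑ c : E → Fin 3, psiTri ends s t o u 𝓤 (pinTri (Function.update p g 1) F τ c 0)
        (pinTri (Function.update p g 0) F τ c 1) (pinTri (Function.update p g 0) F τ c 2)) +
      (∑ c : E → Fin 3, psiTri ends s t o u 𝓤 (pinTri (Function.update p g 0) F τ c 0)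
        (pinTri (Function.update p g 1) F τ c 1) (pinTri (Function.update p g 0) F τ c 2)) +
      (∑ c : E → Fin 3, psiTri ends s t o u 𝓤 (pinTri (Function.update p g 0) F τ c 0)
        (pinTri (Function.update p g 0) F τ c 1) (pinTri (Function.update p g 1) F τ c 2)) =
      3 * psiAnti ends s t o u 𝓤 p (insert g F) (Function.update τ g true) := by
  classical
  set σ := cycAt (E := E) g with hσ
  set f : (E → Fin 3) → R := fun c => psiTri ends s t o u 𝓤
    (pinTri p (insert g F) (Function.update τ g true) c 0)
    (pinTri p (insert g F) (Function.update τ g true) c 1)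
    (pinTri p (insert g F) (Function.update τ g true) c 2) with hf
  have hsum : psiAnti ends s t o u 𝓤 p (insert g F) (Function.update τ g true) = ∑ c, f c := rfl
  have hσ1 : ∑ c, f c = ∑ c, f (σ c) := (Equiv.sum_comp σ f).symm
  have hσ2 : ∑ c, f c = ∑ c, f (σ (σ c)) := by
    rw [hσ1]
    exact (Equiv.sum_comp σ (fun c => f (σ c))).symm
  -- the value of the pinned copy `i` of `insert g F` in terms of `F` and the value `c g`
  have key : ∀ (c : E → Fin 3) (i : Fin 3),
      pinTri p (insert g F) (Function.update τ g true) c i =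
        pinTri (Function.update p g (if c g = i then 1 else 0)) F τ c i := by
    intro c i
    rw [pinTri_insert, Function.update_self, pinTri_update_of_notMem p F τ c i hg]
    congr 1
    have := pinTri_update_tc_of_notMem p F τ c i hg true (c g)
    rw [Function.update_eq_self] at this
    exact this
  have keyσ : ∀ (c : E → Fin 3) (i : Fin 3) (k : Fin 3),
      pinTri (Function.update p g (if (Function.update c g k) g = i then 1 else 0)) F τ
        (Function.update c g k) i =
      pinTri (Function.update p g (if k = i then 1 else 0)) F τ c i := by
    intro c i k
    rw [Function.update_self]
    have := pinTri_update_tc_of_notMem (Function.update p g (if k = i then 1 else 0)) F τ c i hg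
      (τ g) k
    rw [Function.update_eq_self] at this
    exact this
  have hpt : ∀ c : E → Fin 3, f c + f (σ c) + f (σ (σ c)) =
      psiTri ends s t o u 𝓤 (pinTri (Function.update p g 1) F τ c 0)
          (pinTri (Function.update p g 0) F τ c 1) (pinTri (Function.update p g 0) F τ c 2) +
        psiTri ends s t o u 𝓤 (pinTri (Function.update p g 0) F τ c 0)
          (pinTri (Function.update p g 1) F τ c 1) (pinTri (Function.update p g 0) F τ c 2) +
        psiTri ends s t o u 𝓤 (pinTri (Function.update p g 0) F τ c 0)
          (pinTri (Function.update p g 0) F τ c 1) (pinTri (Function.update p g 1) F τ c 2) := by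
    intro c
    have e1 : σ c = Function.update c g (c g + 1) := rfl
    have e2 : σ (σ c) = Function.update c g (c g + 1 + 1) := by
      rw [e1]
      show Function.update (Function.update c g (c g + 1)) g
        ((Function.update c g (c g + 1)) g + 1) = _
      rw [Function.update_self, Function.update_idem]
    simp only [hf]
    rw [e2, e1]
    simp only [key, keyσ]
    have hall : ∀ x : Fin 3, x = 0 ∨ x = 1 ∨ x = 2 := by decide
    rcases hall (c g) with h | h | h <;> simp [h] <;> ring
  calc _ = ∑ c : E → Fin 3, (f c + f (σ c) + f (σ (σ c))) := by
        rw [← Finset.sum_add_distrib, ← Finset.sum_add_distrib]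
        exact Finset.sum_congr rfl fun c _ => (hpt c).symm
    _ = ∑ c, f c + ∑ c, f (σ c) + ∑ c, f (σ (σ c)) := by
        rw [Finset.sum_add_distrib, Finset.sum_add_distrib]
    _ = 3 * psiAnti ends s t o u 𝓤 p (insert g F) (Function.update τ g true) := by
        rw [← hσ1, ← hσ2, hsum]; ring

omit [LinearOrder R] [IsStrictOrderedRing R] in
/-- **The mixed sum of the one-closed terms is `3·M_{F ∪ {g}, τ[g↦false]}`** (`g ∉ F`). -/
lemma psiAnti_mixed_two (ends : E → Sym2 V) (s t o u : V) (𝓤 : Set (Set V)) (p : E → R)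
    {F : Finset E} (τ : E → Bool) {g : E} (hg : g ∉ F) :
    (∑ c : E → Fin 3, psiTri ends s t o u 𝓤 (pinTri (Function.update p g 0) F τ c 0)
        (pinTri (Function.update p g 1) F τ c 1) (pinTri (Function.update p g 1) F τ c 2)) +
      (∑ c : E → Fin 3, psiTri ends s t o u 𝓤 (pinTri (Function.update p g 1) F τ c 0)
        (pinTri (Function.update p g 0) F τ c 1) (pinTri (Function.update p g 1) F τ c 2)) +
      (∑ c : E → Fin 3, psiTri ends s t o u 𝓤 (pinTri (Function.update p g 1) F τ c 0)
        (pinTri (Function.update p g 1) F τ c 1) (pinTri (Function.update p g 0) F τ c 2)) =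
      3 * psiAnti ends s t o u 𝓤 p (insert g F) (Function.update τ g false) := by
  classical
  set σ := cycAt (E := E) g with hσ
  set f : (E → Fin 3) → R := fun c => psiTri ends s t o u 𝓤
    (pinTri p (insert g F) (Function.update τ g false) c 0)
    (pinTri p (insert g F) (Function.update τ g false) c 1)
    (pinTri p (insert g F) (Function.update τ g false) c 2) with hf
  have hsum : psiAnti ends s t o u 𝓤 p (insert g F) (Function.update τ g false) = ∑ c, f c := rfl
  have hσ1 : ∑ c, f c = ∑ c, f (σ c) := (Equiv.sum_comp σ f).symm
  have hσ2 : ∑ c, f c = ∑ c, f (σ (σ c)) := by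
    rw [hσ1]
    exact (Equiv.sum_comp σ (fun c => f (σ c))).symm
  -- the value of the pinned copy `i` of `insert g F` in terms of `F` and the value `c g`
  have key : ∀ (c : E → Fin 3) (i : Fin 3),
      pinTri p (insert g F) (Function.update τ g false) c i =
        pinTri (Function.update p g (if c g = i then 0 else 1)) F τ c i := by
    intro c i
    rw [pinTri_insert, Function.update_self, pinTri_update_of_notMem p F τ c i hg]
    congr 1
    have := pinTri_update_tc_of_notMem p F τ c i hg false (c g)
    rw [Function.update_eq_self] at this
    exact this
  have keyσ : ∀ (c : E → Fin 3) (i : Fin 3) (k : Fin 3),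
      pinTri (Function.update p g (if (Function.update c g k) g = i then 0 else 1)) F τ
        (Function.update c g k) i =
      pinTri (Function.update p g (if k = i then 0 else 1)) F τ c i := by
    intro c i k
    rw [Function.update_self]
    have := pinTri_update_tc_of_notMem (Function.update p g (if k = i then 0 else 1)) F τ c i hg
      (τ g) k
    rw [Function.update_eq_self] at this
    exact this
  have hpt : ∀ c : E → Fin 3, f c + f (σ c) + f (σ (σ c)) =
      psiTri ends s t o u 𝓤 (pinTri (Function.update p g 0) F τ c 0)
          (pinTri (Function.update p g 1) F τ c 1) (pinTri (Function.update p g 1) F τ c 2) +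
        psiTri ends s t o u 𝓤 (pinTri (Function.update p g 1) F τ c 0)
          (pinTri (Function.update p g 0) F τ c 1) (pinTri (Function.update p g 1) F τ c 2) +
        psiTri ends s t o u 𝓤 (pinTri (Function.update p g 1) F τ c 0)
          (pinTri (Function.update p g 1) F τ c 1) (pinTri (Function.update p g 0) F τ c 2) := by
    intro c
    have e1 : σ c = Function.update c g (c g + 1) := rfl
    have e2 : σ (σ c) = Function.update c g (c g + 1 + 1) := by
      rw [e1]
      show Function.update (Function.update c g (c g + 1)) g
        ((Function.update c g (c g + 1)) g + 1) = _
      rw [Function.update_self, Function.update_idem]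
    simp only [hf]
    rw [e2, e1]
    simp only [key, keyσ]
    have hall : ∀ x : Fin 3, x = 0 ∨ x = 1 ∨ x = 2 := by decide
    rcases hall (c g) with h | h | h <;> simp [h] <;> ring
  calc _ = ∑ c : E → Fin 3, (f c + f (σ c) + f (σ (σ c))) := by
        rw [← Finset.sum_add_distrib, ← Finset.sum_add_distrib]
        exact Finset.sum_congr rfl fun c _ => (hpt c).symm
    _ = ∑ c, f c + ∑ c, f (σ c) + ∑ c, f (σ (σ c)) := by
        rw [Finset.sum_add_distrib, Finset.sum_add_distrib]
    _ = 3 * psiAnti ends s t o u 𝓤 p (insert g F) (Function.update τ g false) := by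
        rw [← hσ1, ← hσ2, hsum]; ring

omit [LinearOrder R] [IsStrictOrderedRing R] in
/-- **The one-edge Bernstein expansion of the antipodal coefficient**: for `g ∉ F` and `w = p_g`,
`M_{F,τ}(p) = (1 − w)³·M_{F,τ}(p[g↦0]) + 3w(1 − w)²·M_{F∪{g},τ[g↦true]}(p)
+ 3w²(1 − w)·M_{F∪{g},τ[g↦false]}(p) + w³·M_{F,τ}(p[g↦1])`. -/
lemma psiAnti_bernstein (ends : E → Sym2 V) (s t o u : V) (𝓤 : Set (Set V)) (p : E → R)
    {F : Finset E} (τ : E → Bool) {g : E} (hg : g ∉ F) :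
    psiAnti ends s t o u 𝓤 p F τ =
      (1 - p g) ^ 3 * psiAnti ends s t o u 𝓤 (Function.update p g 0) F τ +
        3 * (p g * (1 - p g) ^ 2) *
          psiAnti ends s t o u 𝓤 p (insert g F) (Function.update τ g true) +
        3 * (p g ^ 2 * (1 - p g)) *
          psiAnti ends s t o u 𝓤 p (insert g F) (Function.update τ g false) +
        p g ^ 3 * psiAnti ends s t o u 𝓤 (Function.update p g 1) F τ := by
  have e1 : ∀ c : E → Fin 3, psiTri ends s t o u 𝓤 (pinTri p F τ c 0) (pinTri p F τ c 1)
      (pinTri p F τ c 2) =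
      (1 - p g) * (1 - p g) * (1 - p g) * psiTri ends s t o u 𝓤
          (pinTri (Function.update p g 0) F τ c 0) (pinTri (Function.update p g 0) F τ c 1)
          (pinTri (Function.update p g 0) F τ c 2) +
        p g * (1 - p g) * (1 - p g) * psiTri ends s t o u 𝓤
          (pinTri (Function.update p g 1) F τ c 0) (pinTri (Function.update p g 0) F τ c 1)
          (pinTri (Function.update p g 0) F τ c 2) +
        (1 - p g) * p g * (1 - p g) * psiTri ends s t o u 𝓤
          (pinTri (Function.update p g 0) F τ c 0) (pinTri (Function.update p g 1) F τ c 1)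
          (pinTri (Function.update p g 0) F τ c 2) +
        (1 - p g) * (1 - p g) * p g * psiTri ends s t o u 𝓤
          (pinTri (Function.update p g 0) F τ c 0) (pinTri (Function.update p g 0) F τ c 1)
          (pinTri (Function.update p g 1) F τ c 2) +
        (1 - p g) * p g * p g * psiTri ends s t o u 𝓤
          (pinTri (Function.update p g 0) F τ c 0) (pinTri (Function.update p g 1) F τ c 1)
          (pinTri (Function.update p g 1) F τ c 2) +
        p g * (1 - p g) * p g * psiTri ends s t o u 𝓤
          (pinTri (Function.update p g 1) F τ c 0) (pinTri (Function.update p g 0) F τ c 1)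
          (pinTri (Function.update p g 1) F τ c 2) +
        p g * p g * (1 - p g) * psiTri ends s t o u 𝓤
          (pinTri (Function.update p g 1) F τ c 0) (pinTri (Function.update p g 1) F τ c 1)
          (pinTri (Function.update p g 0) F τ c 2) +
        p g * p g * p g * psiTri ends s t o u 𝓤
          (pinTri (Function.update p g 1) F τ c 0) (pinTri (Function.update p g 1) F τ c 1)
          (pinTri (Function.update p g 1) F τ c 2) := by
    intro c
    rw [psiTri_bernstein ends s t o u 𝓤 _ _ _ g]
    simp only [pinTri_apply_of_notMem p F τ c _ hg, pinTri_update_of_notMem p F τ c _ hg]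
  have h1 := psiAnti_mixed_one ends s t o u 𝓤 p τ hg
  have h2 := psiAnti_mixed_two ends s t o u 𝓤 p τ hg
  unfold psiAnti at h1 h2 ⊢
  rw [Finset.sum_congr rfl fun c _ => e1 c]
  simp only [Finset.sum_add_distrib, ← Finset.mul_sum]
  linear_combination (p g * (1 - p g) ^ 2) * h1 + (p g ^ 2 * (1 - p g)) * h2

/-- **(Ψ) from (BERN-Ψ-ALL).**  If every antipodal coefficient at every point mass is
nonnegative — `0 ≤ M_{F,τ}(p)` for every `p ∈ {0,1}^E`, every edge set `F` and every type `τ`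
(the nonnegativity of every tensor-Bernstein coefficient of the (Ψ)-polynomial) — then (Ψ) holds
for every admissible weight vector. -/
theorem psi_of_bernall (ends : E → Sym2 V) (s t o u : V) (𝓤 : Set (Set V))
    (hB : ∀ p : E → R, IsProbVec p → (∀ e, p e = 0 ∨ p e = 1) →
      ∀ (F : Finset E) (τ : E → Bool), 0 ≤ psiAnti ends s t o u 𝓤 p F τ) :
    ∀ p : E → R, IsProbVec p → 0 ≤ (prob p (clusterInEvent ends s 𝓤 ∩ (connEvent ends s t)ᶜ) *
        ((prob p (connEvent ends s t)ᶜ - prob p (connEvent ends s u ∩ (connEvent ends s t)ᶜ)) *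
            prob p (clusterInEvent ends t {W : Set V | o ∈ W} ∩ (connEvent ends s t)ᶜ) +
          prob p (connEvent ends s t)ᶜ *
            (prob p (connEvent ends s u ∩ clusterInEvent ends t {W : Set V | o ∈ W} ∩
          (connEvent ends s t)ᶜ) +
              prob p (connEvent ends s u ∩ clusterInEvent ends s {W : Set V | o ∈ W} ∩
          (connEvent ends s t)ᶜ)) -
          prob p (connEvent ends s u ∩ (connEvent ends s t)ᶜ) *
            prob p (clusterInEvent ends s {W : Set V | o ∈ W} ∩ (connEvent ends s t)ᶜ)) -
      prob p (clusterInEvent ends s 𝓤 ∩ clusterInEvent ends t {W : Set V | o ∈ W} ∩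
          (connEvent ends s t)ᶜ) * prob p (connEvent ends s t)ᶜ * prob p (connEvent ends s t)ᶜ) := by
  have key : ∀ p : E → R, IsProbVec p → ∀ (F : Finset E) (τ : E → Bool),
      0 ≤ psiAnti ends s t o u 𝓤 p F τ := by
    refine pin_induction (fun p : E → R => ∀ (F : Finset E) (τ : E → Bool),
      0 ≤ psiAnti ends s t o u 𝓤 p F τ) hB ?_
    intro p hp hex
    obtain ⟨g, hg0, hg1⟩ := hex
    refine ⟨g, hg0, hg1, fun h0 h1 F τ => ?_⟩
    by_cases hgF : g ∈ F
    · rw [← psiAnti_update_of_mem ends s t o u 𝓤 p τ hgF 0]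
      exact h0 F τ
    · rw [psiAnti_bernstein ends s t o u 𝓤 p τ hgF]
      have hm1 : 0 ≤ psiAnti ends s t o u 𝓤 p (insert g F) (Function.update τ g true) := by
        rw [← psiAnti_update_of_mem ends s t o u 𝓤 p _ (Finset.mem_insert_self g F) 0]
        exact h0 _ _
      have hm2 : 0 ≤ psiAnti ends s t o u 𝓤 p (insert g F) (Function.update τ g false) := by
        rw [← psiAnti_update_of_mem ends s t o u 𝓤 p _ (Finset.mem_insert_self g F) 0]
        exact h0 _ _
      have hq0 := hp.nonneg g
      have hq1 := hp.le_one g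
      have hw : 0 ≤ 1 - p g := by linarith
      have ha : 0 ≤ (1 - p g) ^ 3 * psiAnti ends s t o u 𝓤 (Function.update p g 0) F τ :=
        mul_nonneg (pow_nonneg hw 3) (h0 F τ)
      have hb : 0 ≤ 3 * (p g * (1 - p g) ^ 2) *
          psiAnti ends s t o u 𝓤 p (insert g F) (Function.update τ g true) :=
        mul_nonneg (mul_nonneg (by norm_num) (mul_nonneg hq0 (pow_nonneg hw 2))) hm1
      have hc : 0 ≤ 3 * (p g ^ 2 * (1 - p g)) *
          psiAnti ends s t o u 𝓤 p (insert g F) (Function.update τ g false) :=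
        mul_nonneg (mul_nonneg (by norm_num) (mul_nonneg (pow_nonneg hq0 2) hw)) hm2
      have hd : 0 ≤ p g ^ 3 * psiAnti ends s t o u 𝓤 (Function.update p g 1) F τ :=
        mul_nonneg (pow_nonneg hq0 3) (h1 F τ)
      linarith
  intro p hp
  have h := key p hp ∅ (fun _ => true)
  rw [psiAnti_empty] at h
  have hcard : (0 : R) < (Fintype.card (E → Fin 3) : R) := by
    exact_mod_cast Fintype.card_pos
  unfold psiTri at h
  rcases lt_or_ge (prob p (clusterInEvent ends s 𝓤 ∩ (connEvent ends s t)ᶜ) *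
        ((prob p (connEvent ends s t)ᶜ - prob p (connEvent ends s u ∩ (connEvent ends s t)ᶜ)) *
            prob p (clusterInEvent ends t {W : Set V | o ∈ W} ∩ (connEvent ends s t)ᶜ) +
          prob p (connEvent ends s t)ᶜ *
            (prob p (connEvent ends s u ∩ clusterInEvent ends t {W : Set V | o ∈ W} ∩
          (connEvent ends s t)ᶜ) +
              prob p (connEvent ends s u ∩ clusterInEvent ends s {W : Set V | o ∈ W} ∩
          (connEvent ends s t)ᶜ)) -
          prob p (connEvent ends s u ∩ (connEvent ends s t)ᶜ) *
            prob p (clusterInEvent ends s {W : Set V | o ∈ W} ∩ (connEvent ends s t)ᶜ)) -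
      prob p (clusterInEvent ends s 𝓤 ∩ clusterInEvent ends t {W : Set V | o ∈ W} ∩
          (connEvent ends s t)ᶜ) * prob p (connEvent ends s t)ᶜ * prob p (connEvent ends s t)ᶜ) 0
    with hneg | hpos
  · exfalso
    have := mul_neg_of_pos_of_neg hcard hneg
    linarith
  · exact hpos

end PsiBernAll

end Summit.Ventures.PercRepro2
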